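import Literature.Probability.Percolation.TriThetaExponentFromSixFacts
import Literature.Probability.Percolation.KestenScalingFromSeparation
import Literature.Probability.Percolation.FiveArmLowerBound
import Literature.Probability.Percolation.ArmSeparationFourArmProofs
import Literature.Probability.Percolation.OneArmLSWProofs
import HarnessLib

/-!
# `θ(p) = (p - 1/2)^{5/36 + o(1)}` from the two arm exponents and near-critical four-arm separation (assembly, proofs only)

Topic `Literature/Probability/Percolation`; family `crit-perc`, statement **crit-perc.S16**
(`Literature.Probability.Percolation.triTheta_exponent`). PROOFS ONLY: no definition, no named
fact. This file records where the discharge of `triTheta_exponent` stands once every file of the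
near-critical programme is chained together.

The source. S. Smirnov, W. Werner, *Critical exponents for two-dimensional percolation*, Math.
Res. Lett. 8 (2001), Thm. 1 (i) of the arXiv version (math/0109120, p. 4; numbered Thm. 2 in some
printings): "When `p → 1/2+`, `θ(p) = (p - 1/2)^{5/36 + o(1)}`." The printed proof is one
sentence: "It has been shown by Kesten in [Kpaper] … that all these results hold provided that,
when `p = 1/2` and `R → ∞`, `P[A_R^1] = R^{-5/48 + o(1)}` (1) and `P[A_R^2] = R^{-5/4 + o(1)}` (2)",
(1) being Lawler–Schramm–Werner's one-arm exponent and (2) the polychromatic four-arm exponent of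
Thm. 4 (`j = 4`) of the same paper. The tree mirrors this architecture literally:

* (1) is the named fact `oneArm_exponent`, (2) the named fact `fourArm_exponent`
  (`ArmExponents.lean`);
* "[Kpaper]" — Kesten's scaling relations, along W. Werner's Lecture 6 (PCMI 2009) and P. Nolin
  (EJP 2008, §7) — is `triTheta_exponent_of_facts6` (`TriThetaExponentFromSixFacts.lean`):
  `triTheta_exponent` from (1), (2) and the four near-critical arm estimates
  `Werner2009_lemma63`, `Werner2009_fourArm_quasiMult`, `Werner2009_fourArm_lowerBound`,
  `Werner2009_pivotal_lowerBound`, of which `Werner2009_fourArm_lowerBound_holds`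
  (`FiveArmLowerBound.lean`) is a theorem and the other three are theorems conditional on ONE
  discrete input, the comparability below Werner's length `L(p, ε) = charLengthW ε p` of the
  well-separated alternating four-arm event `sepFourArm n N` with the four-arm event
  (`Werner2009_lemma63_of_separation`, `KestenScalingFromSeparation.lean`;
  `Werner2009_fourArm_quasiMult_of_separation`, `NearCriticalFourArmQuasiMult.lean`;
  `Werner2009_pivotal_lowerBound_of_separation`, `PivotalLowerBoundFromSeparation.lean`) — Nolin's
  arm-separation Thm. 11 for `j = 4` below `L(p)` [arXiv 0711.4948: Thm. 10], after Kesten 1987,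
  Lemmas 4–6.

Hence (this file):

* `triTheta_exponent_of_separation` — **`triTheta_exponent` follows from `oneArm_exponent`,
  `fourArm_exponent` and near-critical four-arm separation alone**;
* `critFourArm_separation_of_nearCritical` — the slice `t = 1/2` of the near-critical separation
  hypothesis is the critical separation hypothesis consumed by `fourArm_exponent_of_separation`
  (`ArmSeparationFourArmProofs.lean`), so that ONE separation theorem serves both;
* `fourArm_exponent_of_scalingLimit_of_nearCritical_separation` — (2) from its two continuum
  inputs (SW (16): the scaling limit `π₄(ρ r, ρ R) → L(r, R)`; SW (9) with (15): the `SLE₆`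
  exponent `log L(1, n) / log n → -5/4`) and near-critical separation;
* `triTheta_exponent_of_scalingLimits_of_separation` — **the complete list of what
  `triTheta_exponent_holds` still needs**: Smirnov's / Camia–Newman's scaling limit
  `LawlerSchrammWerner2002_scalingLimit` and LSW's Thm. 1.2 `LawlerSchrammWerner2002_scalingLimitExponent`
  (which give (1): `oneArm_exponent_of_scalingLimit'`, `OneArmLSWProofs.lean`), the two continuum
  inputs for (2), and near-critical four-arm separation. Every discrete-percolation step of
  Smirnov–Werner's sentence other than the separation theorem is proved in the tree.

## References

* S. Smirnov, W. Werner, Critical exponents for two-dimensional percolation, *Math. Res. Lett.* 8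
  (2001) 729–744, Thm. 1 (i) and the paragraph following Thm. 1 (arXiv math/0109120, p. 4);
  Thm. 4, §4 (9), (10), (15), (16) [SmirnovWernerMRL2001].
* H. Kesten, Scaling relations for 2D-percolation, *Comm. Math. Phys.* 109 (1987) 109–156,
  Thm. 2, Cor. 2, (4.5), Lemmas 4–6 [KestenScalingCMP1987].
* G. F. Lawler, O. Schramm, W. Werner, One-arm exponent for critical 2D percolation, *Electron.
  J. Probab.* 7 (2002), no. 2, Thm. 1.1, Thm. 1.2 [LawlerSchrammWernerEJP2002].
* W. Werner, *Lectures on two-dimensional critical percolation*, IAS/Park City Math. Ser. 16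
  (2009), Lecture 5, Thm. 5.2; Lecture 6, Prop. 6.1, Cor. 6.2, Lemma 6.2, Lemma 6.3, Prop. 6.3
  and "End of the proof of the theorem" [WernerPCMI2009].
* P. Nolin, Near-critical percolation in two dimensions, *Electron. J. Probab.* 13 (2008)
  1562–1623, Thm. 11, Prop. 12, Prop. 17, Thm. 27, §7.3 Prop. 34, §7.4 Cor. 41 and (7.25)
  (arXiv 0711.4948: Thm. 10, Prop. 11, Prop. 16, Thm. 26, Prop. 32, Cor. 39) [Nolin2008].

Tree: `triTheta_exponent_of_facts6` (`TriThetaExponentFromSixFacts.lean`),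
`Werner2009_lemma63_of_separation` (`KestenScalingFromSeparation.lean`),
`Werner2009_fourArm_quasiMult_of_separation` (`NearCriticalFourArmQuasiMult.lean`),
`Werner2009_pivotal_lowerBound_of_separation` (`PivotalLowerBoundFromSeparation.lean`),
`Werner2009_fourArm_lowerBound_holds` (`FiveArmLowerBound.lean`), `fourArm_exponent_of_separation`
(`ArmSeparationFourArmProofs.lean`), `oneArm_exponent_of_scalingLimit'` (`OneArmLSWProofs.lean`),
`fourArmProbAt_half` (`WernerPivotalEstimates.lean`). Mathlib: nothing beyond the imports of these
files (Mathlib has no percolation).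
-/

noncomputable section

open Filter
open _root_.Topology

namespace Literature.Probability.Percolation

open LatticeModels

/-- **`θ(p) = (p - 1/2)^{5/36 + o(1)}` from the two arm exponents and near-critical four-arm
separation** (Smirnov–Werner 2001, Thm. 1 (i) and its printed proof: Kesten's scaling relations
applied to the one-arm exponent `5/48` and the four-arm exponent `5/4`). IF `oneArm_exponent` (LSW
2002, Thm. 1.1) and `fourArm_exponent` (SW 2001, Thm. 4, `j = 4`) hold, and the well-separated
alternating four-arm event is comparable to the four-arm event uniformly below Werner's length —
`c · π̂_t(n, N) ≤ P_t(sepFourArm n N)` for `n₀ ≤ n`, `2n ≤ N`, `N ≤ L(t, ε)` if `t > 1/2`,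
`t ∈ [1/2, 1/2 + δ)`, for every small `ε` (Nolin 2008, Thm. 11 for `j = 4` below `L(p)`; Kesten
1987, Lemmas 4–6; Werner 2009, Prop. 6.1) — THEN `triTheta_exponent`: `triTheta_exponent_of_facts6`
with `Werner2009_lemma63_of_separation`, `Werner2009_fourArm_quasiMult_of_separation`,
`Werner2009_fourArm_lowerBound_holds` and `Werner2009_pivotal_lowerBound_of_separation`.
[cite: SmirnovWernerMRL2001, Thm. 1 (i) and the paragraph following Thm. 1 (arXiv math/0109120, p. 4)]
[cite: KestenScalingCMP1987, Thm. 2 and Cor. 2]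
[cite: WernerPCMI2009, Lecture 6, Prop. 6.1, Cor. 6.2, Lemma 6.2, Lemma 6.3 and "End of the proof of the theorem"]
[cite: Nolin2008, Thm. 11 (arXiv 0711.4948: Thm. 10), §7.4 Cor. 41 and (7.25)] -/
theorem triTheta_exponent_of_separation (h₁ : oneArm_exponent) (h₄ : fourArm_exponent)
    (hsep : ∃ ε₁ > (0 : ℝ), ∀ ⦃ε : ℝ⦄, 0 < ε → ε < ε₁ →
      ∃ n₀ : ℕ, ∃ δ > (0 : ℝ), ∃ c > (0 : ℝ),
        ∀ t : unitInterval, 1 / 2 ≤ (t : ℝ) → (t : ℝ) < 1 / 2 + δ →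
          ∀ n N : ℕ, n₀ ≤ n → 2 * n ≤ N → (1 / 2 < (t : ℝ) → N ≤ charLengthW ε t) →
            c * fourArmProbAt t n N ≤ (triSitePercolation t).real (sepFourArm n N)) :
    triTheta_exponent :=
  triTheta_exponent_of_facts6 h₁ h₄ (Werner2009_lemma63_of_separation hsep)
    (Werner2009_fourArm_quasiMult_of_separation hsep) Werner2009_fourArm_lowerBound_holds
    (Werner2009_pivotal_lowerBound_of_separation hsep)

/-- **The critical slice of near-critical four-arm separation.** At `t = 1/2` the restriction
`N ≤ L(t, ε)` is void and `π̂_{1/2}(n, N) = π₄(n, N)` (`fourArmProbAt_half`), so the near-critical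
separation hypothesis contains the critical one consumed by `fourArm_exponent_of_separation`:
`c · π₄(n, N) ≤ P_{1/2}(sepFourArm n N)` for `n₀ ≤ n`, `2n ≤ N`. (Nolin 2008, Thm. 11, stated
uniformly in `p̂ ∈ [P_p, P_{1-p}]`, `n ≤ L(p)`, the case `p = 1/2` included [arXiv 0711.4948: Thm. 10].)
[cite: Nolin2008, Thm. 11 (arXiv 0711.4948: Thm. 10)] -/
theorem critFourArm_separation_of_nearCritical
    (hsep : ∃ ε₁ > (0 : ℝ), ∀ ⦃ε : ℝ⦄, 0 < ε → ε < ε₁ →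
      ∃ n₀ : ℕ, ∃ δ > (0 : ℝ), ∃ c > (0 : ℝ),
        ∀ t : unitInterval, 1 / 2 ≤ (t : ℝ) → (t : ℝ) < 1 / 2 + δ →
          ∀ n N : ℕ, n₀ ≤ n → 2 * n ≤ N → (1 / 2 < (t : ℝ) → N ≤ charLengthW ε t) →
            c * fourArmProbAt t n N ≤ (triSitePercolation t).real (sepFourArm n N)) :
    ∃ c : ℝ, 0 < c ∧ ∃ n₀ : ℕ, ∀ n N : ℕ, n₀ ≤ n → 2 * n ≤ N →
      c * critFourArmProb n N ≤ (triSitePercolation half).real (sepFourArm n N) := by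
  obtain ⟨ε₁, hε₁, h⟩ := hsep
  obtain ⟨n₀, δ, hδ, c, hc, hq⟩ := h (half_pos hε₁) (half_lt_self hε₁)
  refine ⟨c, hc, n₀, fun n N hn hnN => ?_⟩
  have key := hq half (by simp) (by simp; linarith) n N hn hnN (fun hlt => absurd hlt (by simp))
  simpa only [fourArmProbAt_half] using key

/-- **The four-arm exponent from its two continuum inputs and near-critical separation**
(Smirnov–Werner 2001, Thm. 4 for `j = 4`): IF `π₄(ρ r, ρ R) → L(r, R)` as `ρ → ∞` for all
integers `1 ≤ r < R` (SW (16): Smirnov's theorem / the full scaling limit),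
`log L(1, n) / log n → -5/4` (SW (9) with (15): the `SLE₆` exponent `(4² - 1)/12` of
Lawler–Schramm–Werner), and near-critical four-arm separation holds, THEN `fourArm_exponent`:
`fourArm_exponent_of_separation` with `critFourArm_separation_of_nearCritical`.
[cite: SmirnovWernerMRL2001, Thm. 4 (j = 4), §4 (9), (10), (15), (16)]
[cite: Nolin2008, Thm. 11 and Prop. 17 (arXiv 0711.4948: Thm. 10, Prop. 16)] -/
theorem fourArm_exponent_of_scalingLimit_of_nearCritical_separation (L : ℕ → ℕ → ℝ)
    (hlim : ∀ r R : ℕ, 1 ≤ r → r < R →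
      Tendsto (fun ρ : ℕ => critFourArmProb (ρ * r) (ρ * R)) atTop (𝓝 (L r R)))
    (hexp : Tendsto (fun n : ℕ => Real.log (L 1 n) / Real.log n) atTop (𝓝 (-(5 / 4))))
    (hsep : ∃ ε₁ > (0 : ℝ), ∀ ⦃ε : ℝ⦄, 0 < ε → ε < ε₁ →
      ∃ n₀ : ℕ, ∃ δ > (0 : ℝ), ∃ c > (0 : ℝ),
        ∀ t : unitInterval, 1 / 2 ≤ (t : ℝ) → (t : ℝ) < 1 / 2 + δ →
          ∀ n N : ℕ, n₀ ≤ n → 2 * n ≤ N → (1 / 2 < (t : ℝ) → N ≤ charLengthW ε t) →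
            c * fourArmProbAt t n N ≤ (triSitePercolation t).real (sepFourArm n N)) :
    fourArm_exponent :=
  fourArm_exponent_of_separation L hlim hexp (critFourArm_separation_of_nearCritical hsep)

/-- **What `triTheta_exponent_holds` still needs, exactly** (Smirnov–Werner 2001, Thm. 1 (i), with
every discrete step of its printed proof supplied by the tree except the separation theorem).
IF
* the clusters meeting the unit circle have a scaling limit (`h₁`; LSW 2002, §2, p. 3:
  Smirnov 2001 / Camia–Newman 2006) whose law obeys LSW's Thm. 1.2
  (`LawlerSchrammWerner2002_scalingLimitExponent`: the radial `SLE₆` exponent `5/48`) — giving (1)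
  `oneArm_exponent` by `oneArm_exponent_of_scalingLimit'`;
* the critical four-arm probabilities have the scaling limit `π₄(ρ r, ρ R) → L(r, R)` with
  `log L(1, n) / log n → -5/4` (SW (16) and (9): Smirnov's theorem and the `SLE₆` exponent) —
  giving (2) `fourArm_exponent` by `fourArm_exponent_of_scalingLimit_of_nearCritical_separation`;
* near-critical four-arm separation below `L(p)` holds (Nolin 2008, Thm. 11, `j = 4`; Kesten 1987,
  Lemmas 4–6) — giving Kesten's scaling relations by `triTheta_exponent_of_separation`,
THEN `θ(p) = (p - 1/2)^{5/36 + o(1)}` as `p ↓ 1/2`.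
[cite: SmirnovWernerMRL2001, Thm. 1 (i) and the paragraph following Thm. 1 (arXiv math/0109120, p. 4); Thm. 4]
[cite: LawlerSchrammWernerEJP2002, Thm. 1.1 and Thm. 1.2]
[cite: KestenScalingCMP1987, Thm. 2 and Cor. 2]
[cite: Nolin2008, Thm. 11 (arXiv 0711.4948: Thm. 10)] -/
theorem triTheta_exponent_of_scalingLimits_of_separation
    (h₁ : ∃ ν : MeasureTheory.ProbabilityMeasure (TopologicalSpace.NonemptyCompacts ℂ),
      Tendsto lswLaw atTop (𝓝 ν))
    (h₂ : LawlerSchrammWerner2002_scalingLimitExponent)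
    (L : ℕ → ℕ → ℝ)
    (hlim : ∀ r R : ℕ, 1 ≤ r → r < R →
      Tendsto (fun ρ : ℕ => critFourArmProb (ρ * r) (ρ * R)) atTop (𝓝 (L r R)))
    (hexp : Tendsto (fun n : ℕ => Real.log (L 1 n) / Real.log n) atTop (𝓝 (-(5 / 4))))
    (hsep : ∃ ε₁ > (0 : ℝ), ∀ ⦃ε : ℝ⦄, 0 < ε → ε < ε₁ →
      ∃ n₀ : ℕ, ∃ δ > (0 : ℝ), ∃ c > (0 : ℝ),
        ∀ t : unitInterval, 1 / 2 ≤ (t : ℝ) → (t : ℝ) < 1 / 2 + δ →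
          ∀ n N : ℕ, n₀ ≤ n → 2 * n ≤ N → (1 / 2 < (t : ℝ) → N ≤ charLengthW ε t) →
            c * fourArmProbAt t n N ≤ (triSitePercolation t).real (sepFourArm n N)) :
    triTheta_exponent :=
  triTheta_exponent_of_separation (oneArm_exponent_of_scalingLimit' h₁ h₂)
    (fourArm_exponent_of_scalingLimit_of_nearCritical_separation L hlim hexp hsep) hsep

end Literature.Probability.Percolation
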